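import Mathlib
import Summits.QuantumFields.QCD.Theses.PauliWegnerSea
import Literature.MathematicalPhysics.QuantumFieldTheory.QCDHeavyQuarkPropagator
import Literature.MathematicalPhysics.QuantumFieldTheory.QCDWickMinorMeasurability
import Literature.MathematicalPhysics.QuantumFieldTheory.QCDPhaseQuenchedPositivity

/-!
# Stub `stub_aprioriDeterministic` of line `crossing-split-integrability`
(crux `Summit.QuantumFields.QCD.Theses.PauliWegnerSea.PhaseQuenchedFlavourDecay`, item stmt-QuantumFields-9151)

The DETERMINISTIC corner of the line's a-priori estimate `Upper → MinorMoments`: if every bare Wilson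
mass `M_f(k) = m_crit(k) + a_k m_f / Z_m(k)` is eventually `≥ m₀` or `≤ −8 − m₀` (`m₀ > 0`; flavour by
flavour, the side may depend on `f` and on `k`), then on every torus and for every `SU(3)` field the
one-flavour Wilson–Dirac matrix `D_W(M) = (M+4)(1 − x)`, `x = (M+4)⁻¹ Σ_μ W_μ`, has `‖x‖ ≤ 4/|M+4| < 1`
(the hopping part has `ℓ²` operator norm `≤ 4`), so by the Neumann series `det D_W(M) ≠ 0` and every
entry of `D_W(M)⁻¹` has norm `≤ (|M+4| − 4)⁻¹ ≤ m₀⁻¹` on BOTH sides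
(`norm_inv_wilsonDirac_apply_le_of_four_lt_abs`).  The `N_f`-flavour propagator
`(diracMatrix U mq)⁻¹` is flavour-block-diagonal with these blocks (`inv_diracMatrix_apply_same_flavour`,
`inv_diracMatrix_apply_eq_zero_of_fst_ne`), hence all its entries have norm `≤ m₀⁻¹`
(`norm_inv_diracMatrix_apply_le_inv_of_or`); by the Leibniz expansion every `r × r` Wick minor has norm
`≤ r!·m₀^{-r}`, and with `ε = 1`, `C_r = (r!·m₀^{-r})^{1+1}` the minors have phase-quenched
`(1+ε)`-moments `≤ C_r`, uniformly in the torus and in `k` (bounded measurable functions under the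
phase-quenched PROBABILITY measure, `isProbabilityMeasure_qcdLatticeMeasure_all`).  Montvay–Münster
§4.1/§5.1.2 hopping-parameter regime `|κ| < 1/8`, both signs.  The statement below is the REGISTERED stub
signature (tree vocabulary only).
-/

noncomputable section

namespace Summit.QuantumFields.QCD.Cruxes.PhaseQuenchedFlavourDecay.CrossingSplitIntegrability

open scoped BigOperators
open MeasureTheory Filter
open Literature.MathematicalPhysics.QuantumFieldTheory Literature.MathematicalPhysics.QuantumLattice
  Literature.Probability.LatticeModels

/-! ### Configuration-wise Neumann bound for `|M + 4| > 4` (both signs of `M + 4`) -/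

section Neumann

open scoped Matrix.Norms.L2Operator

variable {L N : ℕ} {G : Type*} [Group G] (ρ : G →* Matrix (Fin N) (Fin N) ℂ) [NeZero L]

/-- `‖1 − (M+4)⁻¹ D_W(M)‖₂ ≤ 4/|M+4|` for `M + 4 ≠ 0` (four hopping contractions); the
`|·|`-variant of the tree's `norm_one_sub_smul_wilsonDirac_le`. -/
private theorem norm_one_sub_smul_wilsonDirac_le_abs
    (hρ : ∀ g, ρ g ∈ Matrix.unitaryGroup (Fin N) ℂ) (U : GaugeConfig 4 L G) (M : ℝ)
    (hc : M + 4 ≠ 0) :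
    ‖(1 : Matrix _ _ ℂ) - ((M + 4 : ℝ) : ℂ)⁻¹ • wilsonDirac ρ U M 1‖ ≤ 4 / |M + 4| := by
  -- adapted from `Literature.MathematicalPhysics.QuantumLattice.norm_one_sub_smul_wilsonDirac_le`
  rw [one_sub_smul_wilsonDirac_eq ρ hρ U M hc, norm_smul, norm_inv, Complex.norm_real,
    Real.norm_eq_abs, div_eq_inv_mul]
  gcongr
  calc ‖∑ μ, wilsonHop ρ U μ‖ ≤ ∑ μ, ‖wilsonHop ρ U μ‖ := norm_sum_le _ _
    _ ≤ ∑ _μ : Fin 4, (1 : ℝ) := Finset.sum_le_sum fun μ _ => l2_opNorm_wilsonHop_le ρ hρ U μ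
    _ = 4 := by simp

/-- **Neumann bound on both sides of the hopping band.** For `|M + 4| > 4` (i.e. `M > 0` or
`M < −8`), on every periodic torus and for every gauge field, `det D_W(M) ≠ 0` and every entry of the
propagator satisfies `|D_W(M)⁻¹(p,q)| ≤ (|M+4| − 4)⁻¹`: `D = (M+4)(1 − x)`, `‖x‖ ≤ 4/|M+4| < 1`,
`D⁻¹ = (M+4)⁻¹ Σ_n xⁿ` with `‖Σ_n xⁿ‖ ≤ (1 − 4/|M+4|)⁻¹`, and an entry is bounded by the operator
norm.  Adapted from the tree's `norm_inv_wilsonDirac_apply_le` (`M > 0`, with decay), keeping only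
the `d = 0` bound. -/
private theorem norm_inv_wilsonDirac_apply_le_of_four_lt_abs
    (hρ : ∀ g, ρ g ∈ Matrix.unitaryGroup (Fin N) ℂ) (U : GaugeConfig 4 L G) {M : ℝ}
    (hM : 4 < |M + 4|) :
    (wilsonDirac ρ U M 1).det ≠ 0 ∧
      ∀ p q : TorusSite 4 L × Fin N × Fin 4, ‖(wilsonDirac ρ U M 1)⁻¹ p q‖ ≤ (|M + 4| - 4)⁻¹ := by
  -- adapted from `Literature.MathematicalPhysics.QuantumLattice.norm_inv_wilsonDirac_apply_le`
  set c : ℝ := M + 4 with hcdef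
  have hc0 : 0 < |c| := by linarith
  have hc : c ≠ 0 := abs_pos.1 hc0
  set θ : ℝ := 4 / |c| with hθ
  have hθ1 : θ < 1 := by rwa [hθ, div_lt_one hc0]
  set x : Matrix (TorusSite 4 L × Fin N × Fin 4) (TorusSite 4 L × Fin N × Fin 4) ℂ :=
    1 - ((c : ℝ) : ℂ)⁻¹ • wilsonDirac ρ U M 1 with hx
  have hxn : ‖x‖ ≤ θ := norm_one_sub_smul_wilsonDirac_le_abs ρ hρ U M hc
  have hxn1 : ‖x‖ < 1 := hxn.trans_lt hθ1
  set T : Matrix (TorusSite 4 L × Fin N × Fin 4) (TorusSite 4 L × Fin N × Fin 4) ℂ := ∑' n, x ^ n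
    with hTdef
  have hT1 : (1 - x) * T = 1 := mul_neg_geom_series x hxn1
  have hc' : ((c : ℝ) : ℂ) ≠ 0 := by exact_mod_cast hc
  have hD : wilsonDirac ρ U M 1 = ((c : ℝ) : ℂ) • (1 - x) := by
    rw [hx, sub_sub_cancel, smul_smul, mul_inv_cancel₀ hc', one_smul]
  have hinv : wilsonDirac ρ U M 1 * (((c : ℝ) : ℂ)⁻¹ • T) = 1 := by
    rw [hD, smul_mul_smul_comm, mul_inv_cancel₀ hc', one_smul, hT1]
  have hdet : (wilsonDirac ρ U M 1).det ≠ 0 := by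
    intro h0
    have := congrArg Matrix.det hinv
    rw [Matrix.det_mul, h0, zero_mul, Matrix.det_one] at this
    exact zero_ne_one this
  refine ⟨hdet, fun p q => ?_⟩
  have hTnorm : ‖T‖ ≤ (1 - θ)⁻¹ := by
    refine (tsum_geometric_le_of_norm_lt_one x hxn1).trans ?_
    have h1 := l2_opNorm_torusFermion_one_le (L := L) (N := N)
    have h2 : (1 - ‖x‖)⁻¹ ≤ (1 - θ)⁻¹ := by
      apply inv_anti₀ (by linarith) (by linarith)
    linarith
  have hkey : |c|⁻¹ * (1 - θ)⁻¹ = (|c| - 4)⁻¹ := by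
    rw [hθ, ← mul_inv, mul_sub, mul_one, mul_div_cancel₀ (4 : ℝ) hc0.ne']
  rw [Matrix.inv_eq_right_inv hinv, Matrix.smul_apply, norm_smul, norm_inv, Complex.norm_real,
    Real.norm_eq_abs, ← hkey]
  gcongr
  exact (Literature.MathematicalPhysics.QuantumLattice.norm_apply_le_l2_opNorm T p q).trans hTnorm

end Neumann

/-! ### The `N_f`-flavour propagator and the Wick minors -/

/-- Leibniz bound: a complex `r × r` matrix with entries of norm `≤ x` has `‖det‖ ≤ r!·x^r`. -/
private theorem norm_det_le_of_entry_le {r : ℕ} (A : Matrix (Fin r) (Fin r) ℂ) {x : ℝ}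
    (h : ∀ a b, ‖A a b‖ ≤ x) : ‖A.det‖ ≤ (r.factorial : ℝ) * x ^ r := by
  -- adapted from `PauliWegnerSeaPhaseQuenchedFlavourDecayStubAprioriHeavy.lean`
  rw [Matrix.det_apply']
  calc ‖∑ σ : Equiv.Perm (Fin r), ((Equiv.Perm.sign σ : ℤ) : ℂ) * ∏ i, A (σ i) i‖
      ≤ ∑ σ : Equiv.Perm (Fin r), ‖((Equiv.Perm.sign σ : ℤ) : ℂ) * ∏ i, A (σ i) i‖ := norm_sum_le _ _
    _ ≤ ∑ _σ : Equiv.Perm (Fin r), x ^ r := by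
        refine Finset.sum_le_sum fun σ _ => ?_
        rw [norm_mul]
        have hsign : ‖((Equiv.Perm.sign σ : ℤ) : ℂ)‖ = 1 := by
          rcases Int.units_eq_one_or (Equiv.Perm.sign σ) with h1 | h1 <;> simp [h1]
        rw [hsign, one_mul, norm_prod]
        calc ∏ i, ‖A (σ i) i‖ ≤ ∏ _i : Fin r, x :=
              Finset.prod_le_prod (fun i _ => norm_nonneg _) fun i _ => h _ _
          _ = x ^ r := by rw [Finset.prod_const, Finset.card_univ, Fintype.card_fin]
    _ = (r.factorial : ℝ) * x ^ r := by
        rw [Finset.sum_const, Finset.card_univ, Fintype.card_perm, Fintype.card_fin, nsmul_eq_mul]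

/-- **Two-sided heavy entry bound**: if every bare mass satisfies `m₀ ≤ m_f` or `m_f ≤ −8 − m₀`
(`m₀ > 0`), then EVERY entry of `(diracMatrix U mq)⁻¹` (any two quark variables, any flavours) has norm
`≤ m₀⁻¹`, on every torus and for every field: same-flavour entries are one-flavour propagator entries
(`inv_diracMatrix_apply_same_flavour`, all blocks being invertible by the Neumann bound), bounded by
`(|m_f+4| − 4)⁻¹ ≤ m₀⁻¹`; off-flavour entries vanish. -/
private theorem norm_inv_diracMatrix_apply_le_inv_of_or {Nf S : ℕ} [NeZero S] (U : GaugeConfig 4 S SU3)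
    (mq : Fin Nf → ℝ) {m₀ : ℝ} (hm₀ : 0 < m₀) (hM : ∀ f, m₀ ≤ mq f ∨ mq f ≤ -8 - m₀)
    (v w : QuarkVar Nf S) :
    ‖(diracMatrix U mq)⁻¹ (quarkEquiv v) (quarkEquiv w)‖ ≤ m₀⁻¹ := by
  have habs : ∀ f, 4 < |mq f + 4| ∧ m₀ ≤ |mq f + 4| - 4 := fun f => by
    rcases hM f with h | h
    · rw [abs_of_pos (by linarith)]; constructor <;> linarith
    · rw [abs_of_neg (by linarith)]; constructor <;> linarith
  have hA : ∀ g, (wilsonDirac (fundamentalRep (Fin 3)) U (mq g) 1).det ≠ 0 := fun g =>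
    (norm_inv_wilsonDirac_apply_le_of_four_lt_abs (fundamentalRep (Fin 3))
      fundamentalRep_mem_unitaryGroup U (habs g).1).1
  obtain ⟨f, p⟩ := v
  obtain ⟨g, q⟩ := w
  by_cases hfg : f = g
  · subst hfg
    rw [inv_diracMatrix_apply_same_flavour U mq hA f p q]
    refine ((norm_inv_wilsonDirac_apply_le_of_four_lt_abs (fundamentalRep (Fin 3))
      fundamentalRep_mem_unitaryGroup U (habs f).1).2 p q).trans ?_
    exact inv_anti₀ hm₀ (habs f).2
  · rw [inv_diracMatrix_apply_eq_zero_of_fst_ne U mq (v := (f, p)) (w := (g, q)) hfg, norm_zero]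
    positivity

/-- Registered stub `stub_aprioriDeterministic` of line `crossing-split-integrability` for crux
stmt-QuantumFields-9151 — the deterministic (two-sided hopping-parameter) corner of the a-priori
minor-moment bound: all bare masses eventually `≥ m₀` or `≤ −8 − m₀` (`m₀ > 0`) ⇒ `MinorMoments` with
`ε = 1`, `C_r = (r!·m₀^{-r})^{1+1}`. -/
theorem stub_aprioriDeterministic :
    ∀ (Nf : ℕ) (reg : QCDRegularisation Nf) (m : Fin Nf → ℝ), (∃ m₀ : ℝ, 0 < m₀ ∧ ∀ᶠ k in atTop, ∀ f : Fin Nf, m₀ ≤ reg.mcrit k + reg.a k * m f / reg.Zm k ∨ reg.mcrit k + reg.a k * m f / reg.Zm k ≤ -8 - m₀) → ∃ ε : ℝ, 0 < ε ∧ ∀ r : ℕ, ∃ C : ℝ, ∀ᶠ k in atTop, ∀ S : ℕ, reg.L k ≤ S → ∀ I J : Fin r → QuarkVar Nf (2 * S + 1), Integrable (fun U : GaugeConfig 4 (2 * S + 1) SU3 => ‖(Matrix.of fun a b : Fin r => (diracMatrix U fun fl => reg.mcrit k + reg.a k * m fl / reg.Zm k)⁻¹ (quarkEquiv (I a)) (quarkEquiv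 (J b))).det‖ ^ (1 + ε)) (qcdLatticeMeasure (2 * S + 1) (reg.β k) fun fl => reg.mcrit k + reg.a k * m fl / reg.Zm k) ∧ qcdPhaseQuenchedExpect (reg.β k) (2 * S + 1) (fun fl => reg.mcrit k + reg.a k * m fl / reg.Zm k) (fun U : GaugeConfig 4 (2 * S + 1) SU3 => ‖(Matrix.of fun a b : Fin r => (diracMatrix U fun fl => reg.mcrit k + reg.a k * m fl / reg.Zm k)⁻¹ (quarkEquiv (I a)) (quarkEquiv (J b))).det‖ ^ (1 + ε)) ≤ C := by
  -- adapted from `stub_aprioriHeavy` (PauliWegnerSeaPhaseQuenchedFlavourDecayStubAprioriHeavy.lean)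
  intro Nf reg m hH
  obtain ⟨m₀, hm₀, hM⟩ := hH
  refine ⟨1, one_pos, fun r => ⟨((r.factorial : ℝ) * m₀⁻¹ ^ r) ^ (1 + 1 : ℝ), ?_⟩⟩
  filter_upwards [hM] with k hk S _hS I J
  set mq : Fin Nf → ℝ := fun fl => reg.mcrit k + reg.a k * m fl / reg.Zm k with hmq
  have hkq : ∀ f, m₀ ≤ mq f ∨ mq f ≤ -8 - m₀ := fun f => by rw [hmq]; exact hk f
  set B : ℝ := (r.factorial : ℝ) * m₀⁻¹ ^ r with hB
  set φ : GaugeConfig 4 (2 * S + 1) SU3 → ℝ := fun U =>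
    ‖(Matrix.of fun a b : Fin r => (diracMatrix U mq)⁻¹ (quarkEquiv (I a)) (quarkEquiv (J b))).det‖ ^
      (1 + 1 : ℝ) with hφ
  -- pointwise bound
  have hφ0 : ∀ U, 0 ≤ φ U := fun U => Real.rpow_nonneg (norm_nonneg _) _
  have hφB : ∀ U, φ U ≤ B ^ (1 + 1 : ℝ) := fun U =>
    Real.rpow_le_rpow (norm_nonneg _)
      (norm_det_le_of_entry_le _ fun a b =>
        norm_inv_diracMatrix_apply_le_inv_of_or U mq hm₀ hkq (I a) (J b))
      (by norm_num)
  have hφn : ∀ U, ‖φ U‖ ≤ B ^ (1 + 1 : ℝ) := fun U => by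
    rw [Real.norm_eq_abs, abs_of_nonneg (hφ0 U)]; exact hφB U
  -- measurability
  have hmeas : Measurable φ :=
    (measurable_det_inv_diracMatrix (S := 2 * S + 1) mq (fun a => quarkEquiv (I a))
      (fun b => quarkEquiv (J b))).norm.pow_const _
  -- the phase-quenched measure is a probability measure (at every parameter)
  haveI := isProbabilityMeasure_qcdLatticeMeasure_all (S := 2 * S + 1) (reg.β k) mq
  have hint : Integrable φ (qcdLatticeMeasure (2 * S + 1) (reg.β k) mq) :=
    Integrable.of_bound hmeas.aestronglyMeasurable (B ^ (1 + 1 : ℝ)) (Eventually.of_forall hφn)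
  refine ⟨hint, ?_⟩
  rw [qcdPhaseQuenchedExpect_eq_integral_qcdLatticeMeasure]
  calc ∫ U, φ U ∂(qcdLatticeMeasure (2 * S + 1) (reg.β k) mq)
      ≤ ∫ _U, B ^ (1 + 1 : ℝ) ∂(qcdLatticeMeasure (2 * S + 1) (reg.β k) mq) :=
        integral_mono hint (integrable_const _) hφB
    _ = B ^ (1 + 1 : ℝ) := by simp

end Summit.QuantumFields.QCD.Cruxes.PhaseQuenchedFlavourDecay.CrossingSplitIntegrability

end
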